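import Summits.Ventures.PercRepro.C026HubTwo

/-!
# Theorem H, part 3: the slices of the `abc`-hub (p6, gen 12)

mine-3's THEOREM H (memo §30 add. 4, INBOX 5475) for a hub `v` joined to all three marks:

* **(H3)** `Δ_CF(G + v_{abc}) = 4·Δ_CF(G) + #N² + #apart + (#ac|b − #X_a) + (#bc|a − #X_b)`
  (`slackCF_hub3_abc`), hence `Δ_CF(G + v_{abc}) ≥ 4·Δ_CF(G)` (`slackCF_hub3_abc_ge`);
* **Corollary H**: (CF) on `G` gives (CF) on `G` plus a hub of any type (`slackCF_nonneg_hub3_abc`,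
  with the two-edge types in `C026HubTwo.lean`).

This file evaluates the eight hub-state slices of `slackCF_hub3_eq`: `000, 100, 010` put a mark into
the closed cluster of `c` (`N_AB` empty, the cells are `G`'s); `001` is `G`; `110` is the `ab`-pair
slice (zero); `101` and `011` are the `ac`- / `bc`-pair slices; `111` joins all three marks (only
`N_AB = Λ` survives).  `C026HubCorollary.lean` adds the cell bookkeeping and assembles (H3).
-/

namespace PercRepro

open Finset

namespace MultiGraph

section HubABC

variable {V E : Type*} [Fintype E] {G : MultiGraph V E}

/-! ### The closed-side and open-side shapes of the eight slices -/

omit [Fintype E] in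
/-- Three closed hub edges join all marks in the closed graph: `N_AB` is empty. -/
theorem closed_triple_iff (ω : Config E) (a b c : V) :
    (¬ (G.Conn ω c a ∨ (G.Conn ω c a ∨ G.Conn ω c b ∨ G.Conn ω c c) ∧
        (G.Conn ω a a ∨ G.Conn ω a b ∨ G.Conn ω a c)) ∧
      ¬ (G.Conn ω c b ∨ (G.Conn ω c a ∨ G.Conn ω c b ∨ G.Conn ω c c) ∧
        (G.Conn ω b a ∨ G.Conn ω b b ∨ G.Conn ω b c))) ↔ False := by
  have ha := Conn.refl G ω a
  have hc := Conn.refl G ω c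
  tauto

omit [Fintype E] in
/-- Two closed hub edges at `b, c` put `b` into the closed cluster of `c`: `N_AB` is empty. -/
theorem closed_pair_bc_iff (ω : Config E) (a b c : V) :
    (¬ (G.Conn ω c a ∨ (G.Conn ω c b ∨ G.Conn ω c c) ∧ (G.Conn ω a b ∨ G.Conn ω a c)) ∧
      ¬ (G.Conn ω c b ∨ (G.Conn ω c b ∨ G.Conn ω c c) ∧ (G.Conn ω b b ∨ G.Conn ω b c))) ↔ False := by
  have hb := Conn.refl G ω b
  have hc := Conn.refl G ω c
  tauto

omit [Fintype E] in
/-- Two open hub edges at `b, c`: `a ~ c` in the hub graph is `a ~ c ∨ a ~ b` in `G`. -/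
theorem open_pair_bc_conn_ac_iff (ω : Config E) (a b c : V) :
    (G.Conn ω a c ∨ (G.Conn ω a b ∨ G.Conn ω a c) ∧ (G.Conn ω c b ∨ G.Conn ω c c)) ↔
      (G.Conn ω a c ∨ G.Conn ω a b) := by
  have hc := Conn.refl G ω c
  tauto

omit [Fintype E] in
/-- Two open hub edges at `b, c`: `a ~ b` in the hub graph is `a ~ b ∨ a ~ c` in `G`. -/
theorem open_pair_bc_conn_ab_iff (ω : Config E) (a b c : V) :
    (G.Conn ω a b ∨ (G.Conn ω a b ∨ G.Conn ω a c) ∧ (G.Conn ω b b ∨ G.Conn ω b c)) ↔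
      (G.Conn ω a b ∨ G.Conn ω a c) := by
  have hb := Conn.refl G ω b
  tauto

omit [Fintype E] in
/-- Two open hub edges at `b, c` join `c` and `b`. -/
theorem open_pair_bc_not_cb_iff (ω : Config E) (b c : V) :
    (¬ (G.Conn ω c b ∨ (G.Conn ω c b ∨ G.Conn ω c c) ∧ (G.Conn ω b b ∨ G.Conn ω b c))) ↔ False := by
  have hb := Conn.refl G ω b
  have hc := Conn.refl G ω c
  tauto

omit [Fintype E] in
/-- Two open hub edges at `b, c`: the cell `bc|a` of the hub graph is `a ≁ b ∧ a ≁ c` in `G`. -/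
theorem open_pair_bc_cell_bc_iff (ω : Config E) (a b c : V) :
    ((G.Conn ω c b ∨ (G.Conn ω c b ∨ G.Conn ω c c) ∧ (G.Conn ω b b ∨ G.Conn ω b c)) ∧
      ¬ (G.Conn ω c a ∨ (G.Conn ω c b ∨ G.Conn ω c c) ∧ (G.Conn ω a b ∨ G.Conn ω a c))) ↔
      (¬ G.Conn ω a b ∧ ¬ G.Conn ω a c) := by
  have hb := Conn.refl G ω b
  have hc := Conn.refl G ω c
  have hca : G.Conn ω c a ↔ G.Conn ω a c := conn_comm
  tauto

omit [Fintype E] in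
/-- Three open hub edges join `a` and `c`. -/
theorem open_triple_not_ac_iff (ω : Config E) (a b c : V) :
    (¬ (G.Conn ω a c ∨ (G.Conn ω a a ∨ G.Conn ω a b ∨ G.Conn ω a c) ∧
        (G.Conn ω c a ∨ G.Conn ω c b ∨ G.Conn ω c c))) ↔ False := by
  have ha := Conn.refl G ω a
  have hc := Conn.refl G ω c
  tauto

omit [Fintype E] in
/-- Three open hub edges join `c` and `b`. -/
theorem open_triple_not_cb_iff (ω : Config E) (a b c : V) :
    (¬ (G.Conn ω c b ∨ (G.Conn ω c a ∨ G.Conn ω c b ∨ G.Conn ω c c) ∧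
        (G.Conn ω b a ∨ G.Conn ω b b ∨ G.Conn ω b c))) ↔ False := by
  have hb := Conn.refl G ω b
  have hc := Conn.refl G ω c
  tauto

omit [Fintype E] in
/-- Three open hub edges join `c` and `a`. -/
theorem open_triple_not_ca_iff (ω : Config E) (a b c : V) :
    (¬ (G.Conn ω c a ∨ (G.Conn ω c a ∨ G.Conn ω c b ∨ G.Conn ω c c) ∧
        (G.Conn ω a a ∨ G.Conn ω a b ∨ G.Conn ω a c))) ↔ False := by
  have ha := Conn.refl G ω a
  have hc := Conn.refl G ω c
  tauto

omit [Fintype E] in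
/-- Three open hub edges join `a` and `b`. -/
theorem open_triple_conn_ab_iff (ω : Config E) (a b c : V) :
    (G.Conn ω a b ∨ (G.Conn ω a a ∨ G.Conn ω a b ∨ G.Conn ω a c) ∧
      (G.Conn ω b a ∨ G.Conn ω b b ∨ G.Conn ω b c)) ↔ True := by
  have ha := Conn.refl G ω a
  have hb := Conn.refl G ω b
  tauto

omit [Fintype E] in
/-- `(P ∨ Q) ∧ ¬ (Q ∨ P)` is impossible. -/
theorem or_and_not_or_swap_iff (P Q : Prop) : ((P ∨ Q) ∧ ¬ (Q ∨ P)) ↔ False := by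
  tauto

/-! ### The eight slices -/

open Classical in
/-- Slice `000`: the cells of `G`, no `N_AB`. -/
theorem sliceCF_hub3_fff {v a b c : V} (hv : G.Isolated v) (hav : a ≠ v) (hbv : b ≠ v)
    (hcv : c ≠ v) :
    (G.hub3 v a b c).sliceCF
        (fun ω : Config E => extendOpt false (extendOpt false (extendOpt false ω))) a b c =
      ((univ.filter fun ω : Config E => G.Conn ω a b ∧ ¬ G.Conn ω a c).card : ℤ) +
        ((univ.filter fun ω : Config E => G.Conn ω c a ∧ ¬ G.Conn ω c b).card : ℤ) +
        ((univ.filter fun ω : Config E => G.Conn ω c b ∧ ¬ G.Conn ω c a).card : ℤ) := by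
  have key := sliceCF_eq_of_hubLike
    (R := fun ω x => (false = true ∧ G.Conn ω x a) ∨ (false = true ∧ G.Conn ω x b) ∨
      (false = true ∧ G.Conn ω x c))
    (R' := fun ω x => ((!false) = true ∧ G.Conn ωᶜ x a) ∨ ((!false) = true ∧ G.Conn ωᶜ x b) ∨
      ((!false) = true ∧ G.Conn ωᶜ x c))
    hav hbv hcv (fun ω => hubLike_hub3 hv hav hbv hcv ω false false false) fun ω => by
      rw [compl_hub3]
      exact hubLike_hub3 hv hav hbv hcv ωᶜ (!false) (!false) (!false)
  rw [key]
  simp only [Bool.not_false, Bool.false_eq_true, false_and, or_false, true_and]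
  simp only [closed_triple_iff (a := a) (b := b) (c := c), and_false, Finset.filter_false,
    Finset.card_empty, Nat.cast_zero, sub_zero]

open Classical in
/-- Slice `100`: the cells of `G`, no `N_AB` (`b–v–c` closed puts `b` into `D`). -/
theorem sliceCF_hub3_tff {v a b c : V} (hv : G.Isolated v) (hav : a ≠ v) (hbv : b ≠ v)
    (hcv : c ≠ v) :
    (G.hub3 v a b c).sliceCF
        (fun ω : Config E => extendOpt false (extendOpt false (extendOpt true ω))) a b c =
      ((univ.filter fun ω : Config E => G.Conn ω a b ∧ ¬ G.Conn ω a c).card : ℤ) +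
        ((univ.filter fun ω : Config E => G.Conn ω c a ∧ ¬ G.Conn ω c b).card : ℤ) +
        ((univ.filter fun ω : Config E => G.Conn ω c b ∧ ¬ G.Conn ω c a).card : ℤ) := by
  have key := sliceCF_eq_of_hubLike
    (R := fun ω x => (true = true ∧ G.Conn ω x a) ∨ (false = true ∧ G.Conn ω x b) ∨
      (false = true ∧ G.Conn ω x c))
    (R' := fun ω x => ((!true) = true ∧ G.Conn ωᶜ x a) ∨ ((!false) = true ∧ G.Conn ωᶜ x b) ∨
      ((!false) = true ∧ G.Conn ωᶜ x c))
    hav hbv hcv (fun ω => hubLike_hub3 hv hav hbv hcv ω true false false) fun ω => by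
      rw [compl_hub3]
      exact hubLike_hub3 hv hav hbv hcv ωᶜ (!true) (!false) (!false)
  rw [key]
  simp only [Bool.not_true, Bool.not_false, Bool.false_eq_true, false_and, or_false, false_or,
    true_and, conn_or_leaf]
  simp only [closed_pair_bc_iff (a := a) (b := b) (c := c), and_false, Finset.filter_false,
    Finset.card_empty, Nat.cast_zero, sub_zero]

open Classical in
/-- Slice `010`: the cells of `G`, no `N_AB` (`a–v–c` closed puts `a` into `D`). -/
theorem sliceCF_hub3_ftf {v a b c : V} (hv : G.Isolated v) (hav : a ≠ v) (hbv : b ≠ v)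
    (hcv : c ≠ v) :
    (G.hub3 v a b c).sliceCF
        (fun ω : Config E => extendOpt false (extendOpt true (extendOpt false ω))) a b c =
      ((univ.filter fun ω : Config E => G.Conn ω a b ∧ ¬ G.Conn ω a c).card : ℤ) +
        ((univ.filter fun ω : Config E => G.Conn ω c a ∧ ¬ G.Conn ω c b).card : ℤ) +
        ((univ.filter fun ω : Config E => G.Conn ω c b ∧ ¬ G.Conn ω c a).card : ℤ) := by
  have key := sliceCF_eq_of_hubLike
    (R := fun ω x => (false = true ∧ G.Conn ω x a) ∨ (true = true ∧ G.Conn ω x b) ∨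
      (false = true ∧ G.Conn ω x c))
    (R' := fun ω x => ((!false) = true ∧ G.Conn ωᶜ x a) ∨ ((!true) = true ∧ G.Conn ωᶜ x b) ∨
      ((!false) = true ∧ G.Conn ωᶜ x c))
    hav hbv hcv (fun ω => hubLike_hub3 hv hav hbv hcv ω false true false) fun ω => by
      rw [compl_hub3]
      exact hubLike_hub3 hv hav hbv hcv ωᶜ (!false) (!true) (!false)
  rw [key]
  simp only [Bool.not_true, Bool.not_false, Bool.false_eq_true, false_and, or_false, false_or,
    true_and, conn_or_leaf]
  simp only [closed_pair_ac_iff (a := a) (b := b) (c := c), and_false, Finset.filter_false,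
    Finset.card_empty, Nat.cast_zero, sub_zero]

open Classical in
/-- Slice `001`: `Δ_CF(G)` (a leaf at `c`; `a–v–b` closed changes no event). -/
theorem sliceCF_hub3_fft {v a b c : V} (hv : G.Isolated v) (hav : a ≠ v) (hbv : b ≠ v)
    (hcv : c ≠ v) :
    (G.hub3 v a b c).sliceCF
        (fun ω : Config E => extendOpt true (extendOpt false (extendOpt false ω))) a b c =
      G.slackCF a b c := by
  have key := sliceCF_eq_of_hubLike
    (R := fun ω x => (false = true ∧ G.Conn ω x a) ∨ (false = true ∧ G.Conn ω x b) ∨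
      (true = true ∧ G.Conn ω x c))
    (R' := fun ω x => ((!false) = true ∧ G.Conn ωᶜ x a) ∨ ((!false) = true ∧ G.Conn ωᶜ x b) ∨
      ((!true) = true ∧ G.Conn ωᶜ x c))
    hav hbv hcv (fun ω => hubLike_hub3 hv hav hbv hcv ω false false true) fun ω => by
      rw [compl_hub3]
      exact hubLike_hub3 hv hav hbv hcv ωᶜ (!false) (!false) (!true)
  rw [key]
  unfold slackCF
  simp only [Bool.not_true, Bool.not_false, Bool.false_eq_true, false_and, or_false, false_or,
    true_and, conn_or_leaf]
  simp only [closed_pair_ab_iff (a := a) (b := b) (c := c)]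

open Classical in
/-- Slice `110`: zero (the `ab`-pair slice, a leaf at `c` closed). -/
theorem sliceCF_hub3_ttf {v a b c : V} (hv : G.Isolated v) (hav : a ≠ v) (hbv : b ≠ v)
    (hcv : c ≠ v) :
    (G.hub3 v a b c).sliceCF
        (fun ω : Config E => extendOpt false (extendOpt true (extendOpt true ω))) a b c = 0 := by
  have key := sliceCF_eq_of_hubLike
    (R := fun ω x => (true = true ∧ G.Conn ω x a) ∨ (true = true ∧ G.Conn ω x b) ∨
      (false = true ∧ G.Conn ω x c))
    (R' := fun ω x => ((!true) = true ∧ G.Conn ωᶜ x a) ∨ ((!true) = true ∧ G.Conn ωᶜ x b) ∨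
      ((!false) = true ∧ G.Conn ωᶜ x c))
    hav hbv hcv (fun ω => hubLike_hub3 hv hav hbv hcv ω true true false) fun ω => by
      rw [compl_hub3]
      exact hubLike_hub3 hv hav hbv hcv ωᶜ (!true) (!true) (!false)
  rw [key]
  simp only [Bool.not_true, Bool.not_false, Bool.false_eq_true, false_and, or_false, false_or,
    true_and, conn_or_leaf]
  simp only [open_pair_ab_conn_iff (a := a) (b := b), open_pair_ab_not_ac_iff (a := a) (b := b) (c := c),
    open_pair_ab_cell_ac_iff (a := a) (b := b) (c := c),
    open_pair_ab_cell_bc_iff (a := a) (b := b) (c := c), Finset.filter_false, Finset.card_empty,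
    Nat.cast_zero, add_zero, true_and]
  rw [sub_eq_zero, Nat.cast_inj]
  convert card_filter_compl (fun ω => ¬ G.Conn ω c a ∧ ¬ G.Conn ω c b) using 2 <;>
    (ext ω; simp only [Finset.mem_filter])

open Classical in
/-- Slice `101`: the `ac`-pair slice (a leaf at `b` closed). -/
theorem sliceCF_hub3_tft {v a b c : V} (hv : G.Isolated v) (hav : a ≠ v) (hbv : b ≠ v)
    (hcv : c ≠ v) :
    (G.hub3 v a b c).sliceCF
        (fun ω : Config E => extendOpt true (extendOpt false (extendOpt true ω))) a b c =
      ((univ.filter fun ω : Config E => ¬ G.Conn ω a b ∧ ¬ G.Conn ω b c).card : ℤ) -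
        ((univ.filter fun ω : Config E =>
          (G.Conn ω a b ∨ G.Conn ω c b) ∧ ¬ G.Conn ωᶜ c a ∧ ¬ G.Conn ωᶜ c b).card : ℤ) := by
  have key := sliceCF_eq_of_hubLike
    (R := fun ω x => (true = true ∧ G.Conn ω x a) ∨ (false = true ∧ G.Conn ω x b) ∨
      (true = true ∧ G.Conn ω x c))
    (R' := fun ω x => ((!true) = true ∧ G.Conn ωᶜ x a) ∨ ((!false) = true ∧ G.Conn ωᶜ x b) ∨
      ((!true) = true ∧ G.Conn ωᶜ x c))
    hav hbv hcv (fun ω => hubLike_hub3 hv hav hbv hcv ω true false true) fun ω => by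
      rw [compl_hub3]
      exact hubLike_hub3 hv hav hbv hcv ωᶜ (!true) (!false) (!true)
  rw [key]
  simp only [Bool.not_true, Bool.not_false, Bool.false_eq_true, false_and, or_false, false_or,
    true_and, conn_or_leaf]
  simp only [open_pair_ac_not_ac_iff (a := a) (c := c), open_pair_ac_not_ca_iff (a := a) (c := c),
    and_false, Finset.filter_false, Finset.card_empty, Nat.cast_zero, add_zero, zero_add]
  simp only [open_pair_ac_cell_ac_iff (a := a) (b := b) (c := c),
    open_pair_ac_conn_ab_iff (a := a) (b := b) (c := c)]

open Classical in
/-- Slice `011`: the `bc`-pair slice (a leaf at `a` closed). -/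
theorem sliceCF_hub3_ftt {v a b c : V} (hv : G.Isolated v) (hav : a ≠ v) (hbv : b ≠ v)
    (hcv : c ≠ v) :
    (G.hub3 v a b c).sliceCF
        (fun ω : Config E => extendOpt true (extendOpt true (extendOpt false ω))) a b c =
      ((univ.filter fun ω : Config E => ¬ G.Conn ω a b ∧ ¬ G.Conn ω a c).card : ℤ) -
        ((univ.filter fun ω : Config E =>
          (G.Conn ω a b ∨ G.Conn ω a c) ∧ ¬ G.Conn ωᶜ c a ∧ ¬ G.Conn ωᶜ c b).card : ℤ) := by
  have key := sliceCF_eq_of_hubLike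
    (R := fun ω x => (false = true ∧ G.Conn ω x a) ∨ (true = true ∧ G.Conn ω x b) ∨
      (true = true ∧ G.Conn ω x c))
    (R' := fun ω x => ((!false) = true ∧ G.Conn ωᶜ x a) ∨ ((!true) = true ∧ G.Conn ωᶜ x b) ∨
      ((!true) = true ∧ G.Conn ωᶜ x c))
    hav hbv hcv (fun ω => hubLike_hub3 hv hav hbv hcv ω false true true) fun ω => by
      rw [compl_hub3]
      exact hubLike_hub3 hv hav hbv hcv ωᶜ (!false) (!true) (!true)
  rw [key]
  simp only [Bool.not_true, Bool.not_false, Bool.false_eq_true, false_and, or_false, false_or,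
    true_and, conn_or_leaf]
  simp only [open_pair_bc_not_cb_iff (b := b) (c := c), and_false, Finset.filter_false,
    Finset.card_empty, Nat.cast_zero, add_zero]
  simp only [open_pair_bc_conn_ac_iff (a := a) (b := b) (c := c),
    open_pair_bc_cell_bc_iff (a := a) (b := b) (c := c),
    open_pair_bc_conn_ab_iff (a := a) (b := b) (c := c), or_and_not_or_swap_iff,
    Finset.filter_false, Finset.card_empty, Nat.cast_zero, zero_add]

open Classical in
/-- Slice `111`: all three marks joined; only `N_AB = Λ` survives. -/
theorem sliceCF_hub3_ttt {v a b c : V} (hv : G.Isolated v) (hav : a ≠ v) (hbv : b ≠ v)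
    (hcv : c ≠ v) :
    (G.hub3 v a b c).sliceCF
        (fun ω : Config E => extendOpt true (extendOpt true (extendOpt true ω))) a b c =
      -((univ.filter fun ω : Config E => ¬ G.Conn ωᶜ c a ∧ ¬ G.Conn ωᶜ c b).card : ℤ) := by
  have key := sliceCF_eq_of_hubLike
    (R := fun ω x => (true = true ∧ G.Conn ω x a) ∨ (true = true ∧ G.Conn ω x b) ∨
      (true = true ∧ G.Conn ω x c))
    (R' := fun ω x => ((!true) = true ∧ G.Conn ωᶜ x a) ∨ ((!true) = true ∧ G.Conn ωᶜ x b) ∨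
      ((!true) = true ∧ G.Conn ωᶜ x c))
    hav hbv hcv (fun ω => hubLike_hub3 hv hav hbv hcv ω true true true) fun ω => by
      rw [compl_hub3]
      exact hubLike_hub3 hv hav hbv hcv ωᶜ (!true) (!true) (!true)
  rw [key]
  simp only [Bool.not_true, Bool.false_eq_true, false_and, or_false, true_and]
  simp only [open_triple_not_ac_iff (a := a) (b := b) (c := c),
    open_triple_not_cb_iff (a := a) (b := b) (c := c),
    open_triple_not_ca_iff (a := a) (b := b) (c := c),
    open_triple_conn_ab_iff (a := a) (b := b) (c := c), and_false, true_and, Finset.filter_false,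
    Finset.card_empty, Nat.cast_zero, add_zero, zero_sub]

end HubABC

end MultiGraph

end PercRepro
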